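import Literature.GroupTheory.SpecificGroups.OrthogonalThreeSymmetricNilpotentOrbits   -- ★ p846931∕p846945 (this seat): the classification at `J₀`; brings ★ p846873, ★ p846826, `unitaryGroupOfForm`
import Literature.NumberTheory.Automorphic.UnitaryGroupFormTransport                    -- ★ `formCongr`, `conj_mem_unitaryGroupOfForm`, `formCongr_inv_formCongr`
import HarnessLib

/-!
# The `𝔭`-layer at a tame-ramified place, positive half (3∕3): the classification TRANSPORTED THROUGH A FRAME `J̄ = c • ᵗĀ J₀ Ā` — the consumer's shape
# (`O(J̄)`-conjugacy of nilpotent `J̄`-symmetric residues from (rank, square class); a class function takes ≤ 4 values)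

Topic `Literature/GroupTheory/SpecificGroups`; namespace `Literature.GroupTheory.SpecificGroups`.  THEOREMS ONLY (no definition, no named fact, no instance, no notation,
no `sorry`).  Cell `pub/hodgecm-mathlib` (crux H413 = `stmt-HodgeConjecture-24833`), «S3-ram» seeding wave (LEAD F0P3a-plan (g12); owner∕desk F0P3a-p06 (g15), row «β re-aimed
at the `𝔭`-layer»; seat F0P3-p03 (g14)); sequel of ★ `OrthogonalThreeSymmetricNilpotentOrbitsRankOne` ∕ ★ `OrthogonalThreeSymmetricNilpotentOrbits`.  At a tame-ramified place
the residual form is not `J₀` itself but `J̄ = c̄ • ᵗ(σk Ā) J₀ Ā` for the residue `Ā ∈ GL₃(𝓀)` of an integral antidiagonal frame and a residue action `σk` that IS the identity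
pointwise (★ `exists_residueFrame_of_integralFrame`, ★ `residueHom_galAdicCompletionMap_eq_id_of_ramified`); the depth-one strata-constancy heads (p05 (g15) sf 380b85a5
`apply_eq_apply_of_depthOne_conj_ramified`, F0P2-p01 (g15) (b1) «two-layer (U)-ram head») are stated over `unitaryGroupOfForm σk J̄`.  THIS FILE moves the `J₀`
classification to that shape by `X ↦ Ā X Ā⁻¹` (exactly as ★ `exists_conj_eq_of_rank_sub_one_eq_of_residueFrame` did for ★ p846826): `X` is `J̄`-symmetric iff `ĀXĀ⁻¹` is
`J₀`-symmetric; `O(J̄) = Ā⁻¹ O(J₀) Ā`; the common-value datum rescales by `c`; so — rank `2`: one `O(J̄)`-orbit; rank `≤ 1` with a common non-zero value of `ᵗu J̄X u`: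
one orbit; and an `Ad O(J̄)`-invariant function takes at most the FOUR values `f 0, f(Ā⁻¹N(1)Ā), f(Ā⁻¹N(ε)Ā), f(Ā⁻¹RĀ)` on nilpotent `J̄`-symmetric `X` (finite field, odd
characteristic, `ε` a non-square).
HONEST LABEL: HC_CM is proved only modulo the printed citations (the 2 remaining named inputs hLiu418 24832, h413 24833) until rung 0 closes; elementary `3 × 3` algebra,
nothing printed about the transfer is asserted; count-neutral Literature seeding.

* §1 `formCongr_id_antidiagonal_eq`, `isUnit_det_smul_formCongr_antidiagonal`, `formAdjoint_id_eq_self_iff_transpose_mul`, **`formAdjoint_frameConj_eq_self_of_frame`**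
  (`X ∈ 𝔭(J̄) ⇒ ĀXĀ⁻¹ ∈ 𝔭(J₀)`), `conj_frame_mem_unitaryGroupOfForm_smul_formCongr` (`Ā⁻¹ g Ā ∈ O(J̄)` for `g ∈ O(J₀)`), `dotProduct_smul_formCongr_mul_mulVec`
  (`ᵗu (J̄X) u = c · ᵗ(Āu) (J₀ · ĀXĀ⁻¹) (Āu)`);
* §2 **`exists_conj_eq_of_isNilpotent_of_rank_eq_two_of_residueFrame`**, **`exists_conj_eq_of_isNilpotent_of_rank_le_one_of_common_value_of_residueFrame`**,
  **`apply_mem_four_of_conj_invariant_of_isNilpotent_of_residueFrame`**.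

## References
* [CollingwoodMcGovern1993] D. Collingwood, W. McGovern, *Nilpotent Orbits in Semisimple Lie Algebras* (1993): §9.3 (rational orbits for classical algebras; square classes).
* [Rogawski1990] J. D. Rogawski, *Automorphic Representations of Unitary Groups in Three Variables* (1990): §3.9 p. 32, Prop. 3.9.1 (classes in the maximal compact via the residual group).
* [PlatonovRapinchuk1994] V. Platonov, A. Rapinchuk, *Algebraic Groups and Number Theory* (1994): §3.3 (reduction `G_𝒪 → G_𝓀`; change of frame).
-/

set_option autoImplicit false

open Matrix Literature.NumberTheory.Automorphic Literature.NumberTheory.Automorphic.HermitianLattice Literature.NumberTheory.Automorphic.UnitaryGroup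
open Literature.LinearAlgebra.Matrix

namespace Literature.GroupTheory.SpecificGroups

variable {K : Type*} [Field K]

/-! ## §1 Frame bookkeeping: `J̄ = c • ᵗĀ J₀ Ā` -/

section FrameBasics

/-- `formCongr id Ā J₀ = ᵗĀ J₀ Ā`. [cite: PlatonovRapinchuk1994, §3.3] -/
theorem formCongr_id_antidiagonal_eq (Ab : GL (Fin 3) K) :
    formCongr (RingHom.id K) Ab ((StdForm.antidiagonal 3).over K) = (Ab : Matrix (Fin 3) (Fin 3) K)ᵀ * (StdForm.antidiagonal 3).over K * (Ab : Matrix (Fin 3) (Fin 3) K) := by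
  simp only [formCongr, map_ringHom_id_eq]

/-- `det (c • ᵗĀ J₀ Ā)` is a unit for `c ≠ 0`. [cite: PlatonovRapinchuk1994, §3.3] -/
theorem isUnit_det_smul_formCongr_antidiagonal (Ab : GL (Fin 3) K) {c : K} (hc : c ≠ 0) :
    IsUnit (c • formCongr (RingHom.id K) Ab ((StdForm.antidiagonal 3).over K)).det := by
  rw [formCongr_id_antidiagonal_eq, Matrix.det_smul, Matrix.det_mul, Matrix.det_mul, Matrix.det_transpose, Fintype.card_fin]
  exact (hc.isUnit.pow 3).mul (((Matrix.isUnits_det_units Ab).mul isUnit_det_antidiagonal_three_over).mul (Matrix.isUnits_det_units Ab))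

/-- For an invertible symmetric-or-not `J`: `J⁻¹ Xᵀ J = X ⇔ Xᵀ J = J X`. [cite: PlatonovRapinchuk1994, §3.3] -/
theorem formAdjoint_id_eq_self_iff_transpose_mul {J X : Matrix (Fin 3) (Fin 3) K} (hJ : IsUnit J.det) :
    J⁻¹ * (X.map (RingHom.id K))ᵀ * J = X ↔ Xᵀ * J = J * X := by
  rw [map_ringHom_id_eq]
  have hc : J * (J⁻¹ * Xᵀ * J) = Xᵀ * J := by rw [Matrix.mul_assoc, Matrix.mul_nonsing_inv_cancel_left _ _ hJ]
  constructor
  · intro h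
    rw [← hc, h]
  · intro h
    rw [Matrix.mul_assoc, h, Matrix.nonsing_inv_mul_cancel_left _ _ hJ]

/-- **`X ∈ 𝔭(J̄) ⇒ Ā X Ā⁻¹ ∈ 𝔭(J₀)`** for `J̄ = c • ᵗĀ J₀ Ā`, `c ≠ 0`. [cite: PlatonovRapinchuk1994, §3.3] [cite: CollingwoodMcGovern1993, §9.3] -/
theorem formAdjoint_frameConj_eq_self_of_frame (Ab : GL (Fin 3) K) {c : K} (hc : c ≠ 0) {X : Matrix (Fin 3) (Fin 3) K}
    (hX : (c • formCongr (RingHom.id K) Ab ((StdForm.antidiagonal 3).over K))⁻¹ * (X.map (RingHom.id K))ᵀ *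
      (c • formCongr (RingHom.id K) Ab ((StdForm.antidiagonal 3).over K)) = X) :
    ((StdForm.antidiagonal 3).over K)⁻¹ * ((((Ab : Matrix (Fin 3) (Fin 3) K) * X * ((Ab⁻¹ : GL (Fin 3) K) : Matrix (Fin 3) (Fin 3) K))).map (RingHom.id K))ᵀ *
        (StdForm.antidiagonal 3).over K =
      (Ab : Matrix (Fin 3) (Fin 3) K) * X * ((Ab⁻¹ : GL (Fin 3) K) : Matrix (Fin 3) (Fin 3) K) := by
  have hJ0 := isUnit_det_antidiagonal_three_over (K := K)
  rw [formAdjoint_id_eq_self_iff_transpose_mul (isUnit_det_smul_formCongr_antidiagonal Ab hc), formCongr_id_antidiagonal_eq, Matrix.mul_smul, Matrix.smul_mul,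
    smul_right_inj hc] at hX
  -- `hX : Xᵀ * (ᵗĀ J₀ Ā) = ᵗĀ J₀ Ā * X`
  rw [formAdjoint_id_eq_self_iff_transpose_mul hJ0, Matrix.transpose_mul, Matrix.transpose_mul]
  have h1 : (Ab : Matrix (Fin 3) (Fin 3) K) * ((Ab⁻¹ : GL (Fin 3) K) : Matrix (Fin 3) (Fin 3) K) = 1 := by
    rw [← Units.val_mul, mul_inv_cancel, Units.val_one]
  have h1T : ∀ A : Matrix (Fin 3) (Fin 3) K, ((Ab⁻¹ : GL (Fin 3) K) : Matrix (Fin 3) (Fin 3) K)ᵀ * ((Ab : Matrix (Fin 3) (Fin 3) K)ᵀ * A) = A := fun A => by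
    rw [← Matrix.mul_assoc, ← Matrix.transpose_mul, h1, Matrix.transpose_one, Matrix.one_mul]
  calc ((Ab⁻¹ : GL (Fin 3) K) : Matrix (Fin 3) (Fin 3) K)ᵀ * (Xᵀ * (Ab : Matrix (Fin 3) (Fin 3) K)ᵀ) * (StdForm.antidiagonal 3).over K
      = ((Ab⁻¹ : GL (Fin 3) K) : Matrix (Fin 3) (Fin 3) K)ᵀ * (Xᵀ * ((Ab : Matrix (Fin 3) (Fin 3) K)ᵀ * (StdForm.antidiagonal 3).over K * (Ab : Matrix (Fin 3) (Fin 3) K))) *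
          ((Ab⁻¹ : GL (Fin 3) K) : Matrix (Fin 3) (Fin 3) K) := by
        simp only [Matrix.mul_assoc, h1, Matrix.mul_one]
    _ = ((Ab⁻¹ : GL (Fin 3) K) : Matrix (Fin 3) (Fin 3) K)ᵀ * ((Ab : Matrix (Fin 3) (Fin 3) K)ᵀ * (StdForm.antidiagonal 3).over K * (Ab : Matrix (Fin 3) (Fin 3) K) * X) *
          ((Ab⁻¹ : GL (Fin 3) K) : Matrix (Fin 3) (Fin 3) K) := by rw [hX]
    _ = (StdForm.antidiagonal 3).over K * ((Ab : Matrix (Fin 3) (Fin 3) K) * X * ((Ab⁻¹ : GL (Fin 3) K) : Matrix (Fin 3) (Fin 3) K)) := by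
        simp only [Matrix.mul_assoc, h1T]

/-- **`Ā⁻¹ g Ā ∈ O(J̄)` for `g ∈ O(J₀)`**, `J̄ = c • ᵗĀ J₀ Ā`, `c ≠ 0`. [cite: PlatonovRapinchuk1994, §3.3] -/
theorem conj_frame_mem_unitaryGroupOfForm_smul_formCongr (Ab : GL (Fin 3) K) {c : K} (hc : c ≠ 0) {g : GL (Fin 3) K}
    (hg : g ∈ unitaryGroupOfForm (RingHom.id K) ((StdForm.antidiagonal 3).over K)) :
    Ab⁻¹ * g * Ab ∈ unitaryGroupOfForm (RingHom.id K) (c • formCongr (RingHom.id K) Ab ((StdForm.antidiagonal 3).over K)) := by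
  have hg' : g ∈ unitaryGroupOfForm (RingHom.id K) (formCongr (RingHom.id K) Ab⁻¹ (formCongr (RingHom.id K) Ab ((StdForm.antidiagonal 3).over K))) := by
    rwa [formCongr_inv_formCongr]
  have h := conj_mem_unitaryGroupOfForm (RingHom.id K) Ab⁻¹ _ hg'
  rw [inv_inv] at h
  exact (mem_unitaryGroupOfForm_smul_iff (RingHom.id K) _ hc _).2 h

/-- **The common-value datum through a frame**: `ᵗu (J̄X) u = c · ᵗ(Āu) (J₀·ĀXĀ⁻¹) (Āu)`. [cite: CollingwoodMcGovern1993, §9.3] -/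
theorem dotProduct_smul_formCongr_mul_mulVec (Ab : GL (Fin 3) K) (c : K) (X : Matrix (Fin 3) (Fin 3) K) (u : Fin 3 → K) :
    u ⬝ᵥ ((c • formCongr (RingHom.id K) Ab ((StdForm.antidiagonal 3).over K) * X) *ᵥ u) =
      c * (((Ab : Matrix (Fin 3) (Fin 3) K) *ᵥ u) ⬝ᵥ
        (((StdForm.antidiagonal 3).over K * ((Ab : Matrix (Fin 3) (Fin 3) K) * X * ((Ab⁻¹ : GL (Fin 3) K) : Matrix (Fin 3) (Fin 3) K))) *ᵥ
          ((Ab : Matrix (Fin 3) (Fin 3) K) *ᵥ u))) := by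
  have h2 : ((Ab⁻¹ : GL (Fin 3) K) : Matrix (Fin 3) (Fin 3) K) * (Ab : Matrix (Fin 3) (Fin 3) K) = 1 := by
    rw [← Units.val_mul, inv_mul_cancel, Units.val_one]
  have hM : c • formCongr (RingHom.id K) Ab ((StdForm.antidiagonal 3).over K) * X =
      c • ((Ab : Matrix (Fin 3) (Fin 3) K)ᵀ * (((StdForm.antidiagonal 3).over K * ((Ab : Matrix (Fin 3) (Fin 3) K) * X * ((Ab⁻¹ : GL (Fin 3) K) : Matrix (Fin 3) (Fin 3) K))) *
        (Ab : Matrix (Fin 3) (Fin 3) K))) := by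
    rw [formCongr_id_antidiagonal_eq, Matrix.smul_mul]
    congr 1
    simp only [Matrix.mul_assoc, h2, Matrix.mul_one]
  rw [hM, Matrix.smul_mulVec, dotProduct_smul, smul_eq_mul, ← Matrix.mulVec_mulVec, ← Matrix.mulVec_mulVec, Matrix.dotProduct_mulVec, Matrix.vecMul_transpose]

/-- Conjugation by `Ā` preserves nilpotency. [folklore] [cite: CollingwoodMcGovern1993, §9.3] -/
theorem isNilpotent_frameConj (Ab : GL (Fin 3) K) {X : Matrix (Fin 3) (Fin 3) K} (hX : IsNilpotent X) :
    IsNilpotent ((Ab : Matrix (Fin 3) (Fin 3) K) * X * ((Ab⁻¹ : GL (Fin 3) K) : Matrix (Fin 3) (Fin 3) K)) := by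
  obtain ⟨m, hm⟩ := hX
  exact ⟨m, by rw [Units.conj_pow, hm, Matrix.mul_zero, Matrix.zero_mul]⟩

/-- Conjugation by `Ā` preserves the rank. [folklore] [cite: CollingwoodMcGovern1993, §9.3] -/
theorem rank_frameConj (Ab : GL (Fin 3) K) (X : Matrix (Fin 3) (Fin 3) K) :
    ((Ab : Matrix (Fin 3) (Fin 3) K) * X * ((Ab⁻¹ : GL (Fin 3) K) : Matrix (Fin 3) (Fin 3) K)).rank = X.rank := by
  rw [Matrix.rank_mul_eq_left_of_isUnit_det _ _ (Matrix.isUnits_det_units Ab⁻¹), Matrix.rank_mul_eq_right_of_isUnit_det _ _ (Matrix.isUnits_det_units Ab)]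

/-- `(Ā⁻¹ g Ā) X (Ā⁻¹ g Ā)⁻¹ = Ā⁻¹ (g (ĀXĀ⁻¹) g⁻¹) Ā`. [folklore] [cite: PlatonovRapinchuk1994, §3.3] -/
theorem coe_frameConj_conj (Ab g : GL (Fin 3) K) (X : Matrix (Fin 3) (Fin 3) K) :
    ((Ab⁻¹ * g * Ab : GL (Fin 3) K) : Matrix (Fin 3) (Fin 3) K) * X * (((Ab⁻¹ * g * Ab)⁻¹ : GL (Fin 3) K) : Matrix (Fin 3) (Fin 3) K) =
      ((Ab⁻¹ : GL (Fin 3) K) : Matrix (Fin 3) (Fin 3) K) *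
        ((g : Matrix (Fin 3) (Fin 3) K) * ((Ab : Matrix (Fin 3) (Fin 3) K) * X * ((Ab⁻¹ : GL (Fin 3) K) : Matrix (Fin 3) (Fin 3) K)) * ((g⁻¹ : GL (Fin 3) K) : Matrix (Fin 3) (Fin 3) K)) *
        (Ab : Matrix (Fin 3) (Fin 3) K) := by
  have h := coe_mul_conj Ab⁻¹ (g * Ab) X
  rw [coe_mul_conj g Ab X, inv_inv] at h
  rw [show Ab⁻¹ * g * Ab = Ab⁻¹ * (g * Ab) from mul_assoc _ _ _]
  exact h

end FrameBasics

/-! ## §2 The classification in the consumer's shape `unitaryGroupOfForm σk J̄`, `J̄ = c • formCongr σk Ā J₀`, `σk` pointwise the identity -/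

section Frame

/-- **RANK TWO through a frame**: two nilpotent `J̄`-symmetric `X, X′` of rank `2` are `Ad O(J̄)`-conjugate (`J̄ = c • ᵗ(σ′Ā) J₀ Ā`, `c ≠ 0`, `σ′` pointwise the identity,
`2 ≠ 0`). [cite: CollingwoodMcGovern1993, §9.3] [cite: Rogawski1990, §3.9 p. 32] -/
theorem exists_conj_eq_of_isNilpotent_of_rank_eq_two_of_residueFrame (h2 : (2 : K) ≠ 0) {σ' : K →+* K} (hσ' : ∀ x, σ' x = x)
    (Ab : GL (Fin 3) K) {c : K} (hc : c ≠ 0) {Jb : Matrix (Fin 3) (Fin 3) K} (hJb : Jb = c • formCongr σ' Ab ((StdForm.antidiagonal 3).over K))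
    {X X' : Matrix (Fin 3) (Fin 3) K} (hX : Jb⁻¹ * (X.map σ')ᵀ * Jb = X) (hX' : Jb⁻¹ * (X'.map σ')ᵀ * Jb = X')
    (hnil : IsNilpotent X) (hnil' : IsNilpotent X') (hr : X.rank = 2) (hr' : X'.rank = 2) :
    ∃ y : GL (Fin 3) K, y ∈ unitaryGroupOfForm σ' Jb ∧ (y : Matrix (Fin 3) (Fin 3) K) * X * ((y⁻¹ : GL (Fin 3) K) : Matrix (Fin 3) (Fin 3) K) = X' := by
  obtain rfl : σ' = RingHom.id K := RingHom.ext hσ'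
  subst hJb
  obtain ⟨g, hg, hgY⟩ := exists_orthogonal_conj_eq_of_isNilpotent_of_rank_eq_two h2 (formAdjoint_frameConj_eq_self_of_frame Ab hc hX)
    (formAdjoint_frameConj_eq_self_of_frame Ab hc hX') (isNilpotent_frameConj Ab hnil) (isNilpotent_frameConj Ab hnil')
    (by rw [rank_frameConj]; exact hr) (by rw [rank_frameConj]; exact hr')
  refine ⟨Ab⁻¹ * g * Ab, conj_frame_mem_unitaryGroupOfForm_smul_formCongr Ab hc hg, ?_⟩
  rw [coe_frameConj_conj, hgY, coe_inv_mul_conj_mul_coe]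

/-- **RANK ONE through a frame**: two nilpotent `J̄`-symmetric `X, X′` of rank `≤ 1` whose symmetric forms `J̄X`, `J̄X′` represent a common non-zero value `d` are
`Ad O(J̄)`-conjugate. [cite: CollingwoodMcGovern1993, §9.3] [cite: Rogawski1990, §3.9 p. 32] -/
theorem exists_conj_eq_of_isNilpotent_of_rank_le_one_of_common_value_of_residueFrame {σ' : K →+* K} (hσ' : ∀ x, σ' x = x)
    (Ab : GL (Fin 3) K) {c : K} (hc : c ≠ 0) {Jb : Matrix (Fin 3) (Fin 3) K} (hJb : Jb = c • formCongr σ' Ab ((StdForm.antidiagonal 3).over K))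
    {X X' : Matrix (Fin 3) (Fin 3) K} (hX : Jb⁻¹ * (X.map σ')ᵀ * Jb = X) (hX' : Jb⁻¹ * (X'.map σ')ᵀ * Jb = X')
    (hnil : IsNilpotent X) (hnil' : IsNilpotent X') (hr : X.rank ≤ 1) (hr' : X'.rank ≤ 1) {u u' : Fin 3 → K} {d : K} (hd : d ≠ 0)
    (hu : u ⬝ᵥ ((Jb * X) *ᵥ u) = d) (hu' : u' ⬝ᵥ ((Jb * X') *ᵥ u') = d) :
    ∃ y : GL (Fin 3) K, y ∈ unitaryGroupOfForm σ' Jb ∧ (y : Matrix (Fin 3) (Fin 3) K) * X * ((y⁻¹ : GL (Fin 3) K) : Matrix (Fin 3) (Fin 3) K) = X' := by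
  obtain rfl : σ' = RingHom.id K := RingHom.ext hσ'
  subst hJb
  rw [dotProduct_smul_formCongr_mul_mulVec] at hu hu'
  have hdc : d / c ≠ 0 := div_ne_zero hd hc
  obtain ⟨g, hg, hgY⟩ := exists_orthogonal_conj_eq_of_isNilpotent_of_rank_le_one_of_common_value (formAdjoint_frameConj_eq_self_of_frame Ab hc hX)
    (formAdjoint_frameConj_eq_self_of_frame Ab hc hX') (isNilpotent_frameConj Ab hnil) (isNilpotent_frameConj Ab hnil')
    (by rw [rank_frameConj]; exact hr) (by rw [rank_frameConj]; exact hr') hdc (by rw [← hu]; field_simp) (by rw [← hu']; field_simp)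
  refine ⟨Ab⁻¹ * g * Ab, conj_frame_mem_unitaryGroupOfForm_smul_formCongr Ab hc hg, ?_⟩
  rw [coe_frameConj_conj, hgY, coe_inv_mul_conj_mul_coe]

/-- **At most FOUR values through a frame** (finite field, odd characteristic, `ε` a non-square): an `Ad O(J̄)`-invariant function `f` takes on every nilpotent
`J̄`-symmetric `X` one of the values `f 0`, `f (Ā⁻¹N(1)Ā)`, `f (Ā⁻¹N(ε)Ā)`, `f (Ā⁻¹RĀ)` — the value-table shape of the depth-one strata-constancy organ at a tame-ramified
place. [cite: CollingwoodMcGovern1993, §9.3] [cite: Rogawski1990, §3.9 p. 32] -/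
theorem apply_mem_four_of_conj_invariant_of_isNilpotent_of_residueFrame [Fintype K] (hK : ringChar K ≠ 2) {ε : K} (hε : ¬ IsSquare ε)
    {σ' : K →+* K} (hσ' : ∀ x, σ' x = x) (Ab : GL (Fin 3) K) {c : K} (hc : c ≠ 0) {Jb : Matrix (Fin 3) (Fin 3) K}
    (hJb : Jb = c • formCongr σ' Ab ((StdForm.antidiagonal 3).over K)) {α : Type*} (f : Matrix (Fin 3) (Fin 3) K → α)
    (hf : ∀ y ∈ unitaryGroupOfForm σ' Jb, ∀ Y : Matrix (Fin 3) (Fin 3) K, f ((y : Matrix (Fin 3) (Fin 3) K) * Y * ((y⁻¹ : GL (Fin 3) K) : Matrix (Fin 3) (Fin 3) K)) = f Y)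
    {X : Matrix (Fin 3) (Fin 3) K} (hX : Jb⁻¹ * (X.map σ')ᵀ * Jb = X) (hnil : IsNilpotent X) :
    f X = f 0 ∨
      f X = f (((Ab⁻¹ : GL (Fin 3) K) : Matrix (Fin 3) (Fin 3) K) * !![0, 0, 0; 0, 0, 0; 1, 0, 0] * (Ab : Matrix (Fin 3) (Fin 3) K)) ∨
      f X = f (((Ab⁻¹ : GL (Fin 3) K) : Matrix (Fin 3) (Fin 3) K) * !![0, 0, 0; 0, 0, 0; ε, 0, 0] * (Ab : Matrix (Fin 3) (Fin 3) K)) ∨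
      f X = f (((Ab⁻¹ : GL (Fin 3) K) : Matrix (Fin 3) (Fin 3) K) * !![0, 0, 0; 1, 0, 0; 0, 1, 0] * (Ab : Matrix (Fin 3) (Fin 3) K)) := by
  obtain rfl : σ' = RingHom.id K := RingHom.ext hσ'
  subst hJb
  -- `f₀ Y := f (Ā⁻¹ Y Ā)` is `Ad O(J₀)`-invariant
  have hf₀ : ∀ g ∈ unitaryGroupOfForm (RingHom.id K) ((StdForm.antidiagonal 3).over K), ∀ Y : Matrix (Fin 3) (Fin 3) K,
      f (((Ab⁻¹ : GL (Fin 3) K) : Matrix (Fin 3) (Fin 3) K) * ((g : Matrix (Fin 3) (Fin 3) K) * Y * ((g⁻¹ : GL (Fin 3) K) : Matrix (Fin 3) (Fin 3) K)) *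
          (Ab : Matrix (Fin 3) (Fin 3) K)) =
        f (((Ab⁻¹ : GL (Fin 3) K) : Matrix (Fin 3) (Fin 3) K) * Y * (Ab : Matrix (Fin 3) (Fin 3) K)) := fun g hg Y => by
    have h := hf (Ab⁻¹ * g * Ab) (conj_frame_mem_unitaryGroupOfForm_smul_formCongr Ab hc hg)
      (((Ab⁻¹ : GL (Fin 3) K) : Matrix (Fin 3) (Fin 3) K) * Y * (Ab : Matrix (Fin 3) (Fin 3) K))
    have hc' := coe_inv_mul_conj_mul_coe Ab⁻¹ Y
    rw [inv_inv] at hc'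
    rw [coe_frameConj_conj, hc'] at h
    exact h
  have h4 := apply_mem_four_of_conj_invariant_of_isNilpotent hK hε
    (fun Y => f (((Ab⁻¹ : GL (Fin 3) K) : Matrix (Fin 3) (Fin 3) K) * Y * (Ab : Matrix (Fin 3) (Fin 3) K))) hf₀
    (formAdjoint_frameConj_eq_self_of_frame Ab hc hX) (isNilpotent_frameConj Ab hnil)
  simp only [coe_inv_mul_conj_mul_coe, Matrix.mul_zero, Matrix.zero_mul] at h4
  exact h4

end Frame

end Literature.GroupTheory.SpecificGroups
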